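import Literature.Barriers.RiemannHypothesis.TuranPartialSumsMontgomeryTwist
import Literature.Barriers.RiemannHypothesis.TuranPartialSumsMontgomeryPrimeSum
import Mathlib.NumberTheory.EulerProduct.ExpLog
import Mathlib.Analysis.Calculus.SmoothSeries
import Mathlib.Analysis.Normed.Ring.InfiniteSum
import HarnessLib

/-!
# Montgomery 1983, §3 — the Dirichlet series `f(s) = Σ a(n) n^{-s}` of the twist and `log f = Φ`

Companion of `Literature/Barriers/RiemannHypothesis/TuranPartialSums.lean` (named fact
`Literature.Barriers.RiemannHypothesis.Montgomery1983_theorem`, Montgomery 1983, Theorem p. 497), building on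
`TuranPartialSumsMontgomeryTwist.lean` (the multiplicative function `a = montgomeryTwist m`, (8)–(13)) and
`TuranPartialSumsMontgomeryPrimeSum.lean` (the prime zeta function `P`, Lemmas 2–3).

Following §3 of the source we define `f(s) = Σ_n a(n) n^{-s}` (`montgomeryF`, (6)) and prove the Euler-product
formula (15): `f(s) = exp Φ(s)` for `σ > 1` with
`Φ(s) = Σ_k b̂(k) P(s − ik) + R(s)` (`montgomeryPhi`, (14)), `R(s) = Σ_p (−log(1 − a(p)p^{-s}) − a(p)p^{-s})`
holomorphic and bounded (with its derivative) on `σ ≥ 1` (`norm_montgomeryR_le`, `hasDerivAt_montgomeryR`,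
`norm_tsum_montgomeryRTermDeriv_le`); the termwise derivative `Φ'` (`montgomeryPhiDeriv`,
`hasDerivAt_montgomeryPhi`) and `f' = Φ' f` (`hasDerivAt_montgomeryF`); and the structural Lemma 4 in the
quantitative form used in §4: for `1 < σ ≤ 2`, `|t − k| ≤ 1/2`,
`‖Φ(s) + b̂(k) log(s − 1 − ik)‖ ≤ A₁ + A₂ log log(|k| + 5)` (`exists_norm_phi_add_log_le`, (18)) and
`‖Φ'(s) + b̂(k)/(s − 1 − ik)‖ ≤ A₃ + A₄ log(|k| + 5)` (`exists_norm_phiDeriv_add_inv_le`, (19)).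

Design note: the source continues `P` (hence `Φ`, `g_k`) a little to the left of `σ = 1` into the classical
zero-free region; the present formalisation only ever uses the half-plane `σ > 1` (the contour of §4 is taken on
`Re(s + w) = 1 + 1/log x`), so Lemma 4 is stated and proved for `1 < σ ≤ 2` only.

## References

* [Montgomery1983] H. L. Montgomery, *Zeros of approximations to the zeta function*, Studies in Pure
  Mathematics (Turán memorial), Birkhäuser 1983, 497–506: §3, (6), (14), (15), Lemma 4 (18)–(19).
-/

noncomputable section

open Complex Set Filter Topology LSeries

namespace Literature.Barriers.RiemannHypothesis


section Euler

variable (m : ℕ)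

/-! ## The twisted Dirichlet series `f(z) = Σ a(n) n^{-z}` -/

/-- The summands `a(n) n^{-z}` as a monoid-with-zero homomorphism in `n` (for the Euler product).
[cite: Montgomery1983, §2 (3)] -/
def twistSummandHom (ψ : ℕ →*₀ ℂ) (z : ℂ) : ℕ →*₀ ℂ where
  toFun n := ψ n * (n : ℂ) ^ (-z)
  map_zero' := by simp
  map_one' := by simp
  map_mul' a b := by
    rw [map_mul, Nat.cast_mul, natCast_mul_natCast_cpow]
    ring

/-- `‖a(n) n^{-z}‖ ≤ n^{-Re z}`. [folklore] -/
theorem norm_twistSummandHom_le {ψ : ℕ →*₀ ℂ} (hψ : ∀ n, ‖ψ n‖ ≤ 1) (z : ℂ) (n : ℕ) :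
    ‖twistSummandHom ψ z n‖ ≤ (n : ℝ) ^ (-z.re) := by
  show ‖ψ n * (n : ℂ) ^ (-z)‖ ≤ _
  rcases eq_or_ne n 0 with rfl | hn
  · rw [map_zero, zero_mul, norm_zero]
    exact Real.rpow_nonneg (Nat.cast_nonneg 0) _
  rw [norm_mul, norm_natCast_cpow_of_pos (Nat.pos_of_ne_zero hn), neg_re]
  calc ‖ψ n‖ * (n : ℝ) ^ (-z.re) ≤ 1 * (n : ℝ) ^ (-z.re) :=
        mul_le_mul_of_nonneg_right (hψ n) (Real.rpow_nonneg (Nat.cast_nonneg n) _)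
    _ = _ := one_mul _

/-- The summands are absolutely summable for `Re z > 1`. [folklore] -/
theorem summable_norm_twistSummandHom {ψ : ℕ →*₀ ℂ} (hψ : ∀ n, ‖ψ n‖ ≤ 1) {z : ℂ} (hz : 1 < z.re) :
    Summable fun n ↦ ‖twistSummandHom ψ z n‖ :=
  Summable.of_nonneg_of_le (fun n ↦ norm_nonneg _) (norm_twistSummandHom_le hψ z)
    (Real.summable_nat_rpow.2 (by linarith))

/-- **Montgomery's `f(s) = Σ a(n) n^{-s}`** for the twist `a = montgomeryTwist m` (an `LSeries`).
[cite: Montgomery1983, §2] -/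
def montgomeryF (z : ℂ) : ℂ := LSeries (fun n ↦ montgomeryTwist m n) z

/-- `f(z) = Σ_n a(n)n^{-z}` as the sum of the monoid-hom summands. [folklore] -/
theorem montgomeryF_eq_tsum (z : ℂ) : montgomeryF m z = ∑' n : ℕ, twistSummandHom (montgomeryTwist m) z n := by
  rw [montgomeryF, LSeries]
  refine tsum_congr fun n ↦ ?_
  rcases eq_or_ne n 0 with rfl | hn
  · simp [twistSummandHom]
  · rw [LSeries.term_of_ne_zero hn, div_eq_mul_inv, ← cpow_neg]; rfl

/-- **The Euler product in exponential form**: `f(z) = exp(Σ_p −log(1 − a(p)p^{-z}))` for `Re z > 1`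
(Mathlib's `EulerProduct.exp_tsum_primes_log_eq_tsum`). [cite: Montgomery1983, §3 (display before (14))] -/
theorem montgomeryF_eq_exp_tsum_primes {z : ℂ} (hz : 1 < z.re) :
    montgomeryF m z = exp (∑' p : Nat.Primes, -log (1 - montgomeryTwist m p * ((p : ℕ) : ℂ) ^ (-z))) := by
  rw [montgomeryF_eq_tsum]
  exact (EulerProduct.exp_tsum_primes_log_eq_tsum
    (summable_norm_twistSummandHom (norm_montgomeryTwist_le_one m) hz)).symm

/-! ## The logarithm: `Σ_p −log(1 − a(p)p^{-z}) = Σ_p a(p)p^{-z} + R(z)` -/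

/-- The prime-power remainder `R(z) = Σ_p (−log(1 − a(p)p^{-z}) − a(p)p^{-z})` ("`log f₃`" of the
source: "`log f₃(s) ≪ Σ_{p^k, k ≥ 2} p^{-kσ} ≪ Σ_p p^{-2σ}`", Lemma 2). [cite: Montgomery1983, Lemma 2 (16)] -/
def montgomeryR (z : ℂ) : ℂ :=
  ∑' p : Nat.Primes, (-log (1 - montgomeryTwist m p * ((p : ℕ) : ℂ) ^ (-z)) -
    montgomeryTwist m p * ((p : ℕ) : ℂ) ^ (-z))

/-- `‖a(p)p^{-z}‖ = p^{-Re z} ≤ 2^{-Re z}`. [folklore] -/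
theorem norm_twist_mul_cpow (p : Nat.Primes) (z : ℂ) :
    ‖montgomeryTwist m p * ((p : ℕ) : ℂ) ^ (-z)‖ = ((p : ℕ) : ℝ) ^ (-z.re) := by
  rw [norm_mul, norm_montgomeryTwist_prime m p.2, one_mul, norm_natCast_cpow_of_pos p.2.pos, neg_re]

/-- `‖a(p)p^{-z}‖ ≤ 1/2` for `Re z ≥ 1`. [folklore] -/
theorem norm_twist_mul_cpow_le_half (p : Nat.Primes) {z : ℂ} (hz : 1 ≤ z.re) :
    ‖montgomeryTwist m p * ((p : ℕ) : ℂ) ^ (-z)‖ ≤ 1 / 2 := by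
  rw [norm_twist_mul_cpow]
  have hp : (2 : ℝ) ≤ (p : ℕ) := by exact_mod_cast p.2.two_le
  calc ((p : ℕ) : ℝ) ^ (-z.re) ≤ (2 : ℝ) ^ (-z.re) :=
        Real.rpow_le_rpow_of_nonpos (by norm_num) hp (by linarith)
    _ ≤ (2 : ℝ) ^ (-1 : ℝ) := Real.rpow_le_rpow_of_exponent_le (by norm_num) (by linarith)
    _ = 1 / 2 := by norm_num

/-- Termwise bound for `R`: `‖−log(1−w) − w‖ ≤ ‖w‖² ≤ p^{-2}` (`Re z ≥ 1`). [cite: Montgomery1983, Lemma 2] -/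
theorem norm_montgomeryR_term_le (p : Nat.Primes) {z : ℂ} (hz : 1 ≤ z.re) :
    ‖(-log (1 - montgomeryTwist m p * ((p : ℕ) : ℂ) ^ (-z)) -
        montgomeryTwist m p * ((p : ℕ) : ℂ) ^ (-z))‖ ≤ ((p : ℕ) : ℝ) ^ (-2 : ℝ) := by
  have h := Literature.NumberTheory.LFunctions.norm_neg_log_one_sub_sub_le
    (norm_twist_mul_cpow_le_half m p hz)
  refine h.trans ?_
  rw [norm_twist_mul_cpow, ← Real.rpow_natCast, ← Real.rpow_mul (Nat.cast_nonneg _)]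
  refine Real.rpow_le_rpow_of_exponent_le (by exact_mod_cast p.2.one_lt.le) ?_
  push_cast; linarith

/-- `R` converges absolutely, `‖R(z)‖ ≤ Σ_p p^{-2}` for `Re z ≥ 1` (Lemma 2: `log f₃` is uniformly bounded).
[cite: Montgomery1983, Lemma 2] -/
theorem norm_montgomeryR_le {z : ℂ} (hz : 1 ≤ z.re) : ‖montgomeryR m z‖ ≤ primeSumTwo := by
  unfold montgomeryR primeSumTwo
  have hs : Summable fun p : Nat.Primes ↦ ((p : ℕ) : ℝ) ^ (-2 : ℝ) :=
    Literature.NumberTheory.LFunctions.summable_primes_rpow_neg_two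
  refine (norm_tsum_le_tsum_norm ?_).trans (Summable.tsum_le_tsum (fun p ↦ norm_montgomeryR_term_le m p hz)
    ?_ hs)
  · exact Summable.of_nonneg_of_le (fun p ↦ norm_nonneg _) (fun p ↦ norm_montgomeryR_term_le m p hz) hs
  · exact Summable.of_nonneg_of_le (fun p ↦ norm_nonneg _) (fun p ↦ norm_montgomeryR_term_le m p hz) hs

/-- The prime sum of the twist, `Σ_p a(p) p^{-z}`, converges absolutely for `Re z > 1`. [folklore] -/
theorem summable_twist_mul_cpow {z : ℂ} (hz : 1 < z.re) :
    Summable fun p : Nat.Primes ↦ montgomeryTwist m p * ((p : ℕ) : ℂ) ^ (-z) := by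
  refine Summable.of_norm ?_
  simp_rw [norm_twist_mul_cpow]
  exact summable_primes_rpow_neg_re hz

/-- `Σ_p −log(1 − a(p)p^{-z}) = Σ_p a(p)p^{-z} + R(z)` (`Re z > 1`). [cite: Montgomery1983, §3 (15)–(16)] -/
theorem tsum_neg_log_eq_add_R {z : ℂ} (hz : 1 < z.re) :
    ∑' p : Nat.Primes, -log (1 - montgomeryTwist m p * ((p : ℕ) : ℂ) ^ (-z)) =
      (∑' p : Nat.Primes, montgomeryTwist m p * ((p : ℕ) : ℂ) ^ (-z)) + montgomeryR m z := by
  rw [montgomeryR, ← (summable_twist_mul_cpow m hz).tsum_add]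
  · exact tsum_congr fun p ↦ by ring
  · exact Summable.of_norm (Summable.of_nonneg_of_le (fun p ↦ norm_nonneg _)
      (fun p ↦ norm_montgomeryR_term_le m p hz.le)
      Literature.NumberTheory.LFunctions.summable_primes_rpow_neg_two)

/-! ## `Σ_p a(p) p^{-z} = Σ_k b̂(k) P(z − ik)` -/

/-- The double family `(p, k) ↦ b̂(k) p^{ik} p^{-z}` is absolutely summable (`Re z > 1`). [folklore] -/
theorem summable_coeff_prime_family {z : ℂ} (hz : 1 < z.re) :
    Summable fun pk : Nat.Primes × ℤ ↦
      ((montgomeryCoeff m pk.2 : ℂ) * ((pk.1 : ℕ) : ℂ) ^ ((pk.2 : ℂ) * I)) * ((pk.1 : ℕ) : ℂ) ^ (-z) := by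
  have h1 : Summable fun p : Nat.Primes ↦ ‖((p : ℕ) : ℂ) ^ (-z)‖ := by
    simp_rw [fun p : Nat.Primes ↦ norm_natCast_cpow_of_pos p.2.pos (-z), neg_re]
    exact summable_primes_rpow_neg_re hz
  have h2 : Summable fun k : ℤ ↦ ‖(montgomeryCoeff m k : ℂ)‖ := by
    simp_rw [norm_real, Real.norm_eq_abs]; exact summable_abs_montgomeryCoeff m
  have h3 := h1.mul_norm h2
  refine Summable.of_norm_bounded h3 fun pk ↦ ?_
  have hu : ‖((pk.1 : ℕ) : ℂ) ^ ((pk.2 : ℂ) * I)‖ = 1 := by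
    rw [norm_natCast_cpow_of_pos pk.1.2.pos]; simp
  rw [norm_mul, norm_mul, hu, mul_one, norm_mul, mul_comm]

/-- **`Σ_p a(p)p^{-z} = Σ_k b̂(k) P(z − ik)`** for `Re z > 1`: the pointwise expansion
`a(p) = Σ_k b̂(k)p^{ik}` summed over the primes (absolutely convergent double series) —
the source's `Σ_n (Λ(n)/log n) a*(n) n^{-s} = Σ_n (Λ(n)/log n) n^{-s} Σ_k b̂(k) n^{ik}` restricted to the
primes. [cite: Montgomery1983, §3 (display before (14))] -/
theorem tsum_twist_mul_cpow_eq {z : ℂ} (hz : 1 < z.re) :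
    ∑' p : Nat.Primes, montgomeryTwist m p * ((p : ℕ) : ℂ) ^ (-z) =
      ∑' k : ℤ, (montgomeryCoeff m k : ℂ) * montgomeryP (z - k * I) := by
  set F : Nat.Primes → ℤ → ℂ := fun p k ↦
    ((montgomeryCoeff m k : ℂ) * ((p : ℕ) : ℂ) ^ ((k : ℂ) * I)) * ((p : ℕ) : ℂ) ^ (-z) with hF
  have hsum : Summable (Function.uncurry F) := summable_coeff_prime_family m hz
  -- inner sums over `k`: the expansion of `a(p)`, times `p^{-z}`
  have hp : ∀ p : Nat.Primes, HasSum (F p) (montgomeryTwist m p * ((p : ℕ) : ℂ) ^ (-z)) := fun p ↦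
    (hasSum_montgomeryTwist_prime m p.2).mul_right _
  -- inner sums over `p`: `b̂(k) P(z - ik)`
  have hk : ∀ k : ℤ, HasSum (fun p ↦ F p k) ((montgomeryCoeff m k : ℂ) * montgomeryP (z - k * I)) := by
    intro k
    have hre : 1 < (z - k * I).re := by simpa using hz
    have hP : HasSum (fun p : Nat.Primes ↦ ((p : ℕ) : ℂ) ^ (-(z - k * I))) (montgomeryP (z - k * I)) := by
      rw [montgomeryP_eq_tsum_primes]
      exact (Summable.of_norm (by
        simp_rw [fun p : Nat.Primes ↦ norm_natCast_cpow_of_pos p.2.pos (-(z - k * I)), neg_re]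
        exact summable_primes_rpow_neg_re hre)).hasSum
    refine (hP.mul_left (montgomeryCoeff m k : ℂ)).congr_fun fun p ↦ ?_
    simp only [hF]
    have hp0 : ((p : ℕ) : ℂ) ≠ 0 := by exact_mod_cast p.2.ne_zero
    rw [mul_assoc, ← cpow_add _ _ hp0]
    congr 2
    ring
  calc ∑' p : Nat.Primes, montgomeryTwist m p * ((p : ℕ) : ℂ) ^ (-z)
      = ∑' p : Nat.Primes, ∑' k : ℤ, F p k := tsum_congr fun p ↦ (hp p).tsum_eq.symm
    _ = ∑' k : ℤ, ∑' p : Nat.Primes, F p k :=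
        (hsum.tsum_comm' (fun p ↦ (hp p).summable) (fun k ↦ (hk k).summable)).symm
    _ = ∑' k : ℤ, (montgomeryCoeff m k : ℂ) * montgomeryP (z - k * I) :=
        tsum_congr fun k ↦ (hk k).tsum_eq

/-! ## `f = exp Φ` with `Φ(z) = Σ_k b̂(k) P(z − ik) + R(z)` -/

/-- **The exponent** `Φ(z) = Σ_k b̂(k) P(z − ik) + R(z)`, the form on `σ > 1` of the source's
`log f(s) = Σ_k b̂(k) log ζ(s − ik) + log f₃(s)` ((14)–(16)). [cite: Montgomery1983, §3 (14)–(16)] -/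
def montgomeryPhi (z : ℂ) : ℂ :=
  (∑' k : ℤ, (montgomeryCoeff m k : ℂ) * montgomeryP (z - k * I)) + montgomeryR m z

/-- **`f(z) = exp Φ(z)`** for `Re z > 1` ((15): `f = f₁f₂f₃`, here without splitting the `k`-sum).
[cite: Montgomery1983, §3 (15)] -/
theorem montgomeryF_eq_exp_phi {z : ℂ} (hz : 1 < z.re) : montgomeryF m z = exp (montgomeryPhi m z) := by
  rw [montgomeryF_eq_exp_tsum_primes m hz, tsum_neg_log_eq_add_R m hz, tsum_twist_mul_cpow_eq m hz,
    montgomeryPhi]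

/-- `f(z) ≠ 0` for `Re z > 1`. [folklore] -/
theorem montgomeryF_ne_zero {z : ℂ} (hz : 1 < z.re) : montgomeryF m z ≠ 0 := by
  rw [montgomeryF_eq_exp_phi m hz]; exact exp_ne_zero _

/-- `‖f(z)‖ = exp(Re Φ(z))` for `Re z > 1`. [folklore] -/
theorem norm_montgomeryF_eq {z : ℂ} (hz : 1 < z.re) : ‖montgomeryF m z‖ = Real.exp (montgomeryPhi m z).re := by
  rw [montgomeryF_eq_exp_phi m hz, norm_exp]

/-! ## The derivative of `R` -/

/-- The terms of `R`. [cite: Montgomery1983, Lemma 2 (16)] -/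
def montgomeryRTerm (p : Nat.Primes) (z : ℂ) : ℂ :=
  (-log (1 - montgomeryTwist m p * ((p : ℕ) : ℂ) ^ (-z)) - montgomeryTwist m p * ((p : ℕ) : ℂ) ^ (-z))

/-- The derivative of the terms of `R`: with `w = a(p)p^{-z}`, `w' = −(log p) w`,
`(−log(1−w) − w)' = w'·w/(1 − w)`. [folklore] -/
def montgomeryRTermDeriv (p : Nat.Primes) (z : ℂ) : ℂ :=
  (-(Real.log (p : ℕ) : ℂ) * (montgomeryTwist m p * ((p : ℕ) : ℂ) ^ (-z))) *
    (montgomeryTwist m p * ((p : ℕ) : ℂ) ^ (-z)) / (1 - montgomeryTwist m p * ((p : ℕ) : ℂ) ^ (-z))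

/-- `z ↦ p^{-z}` has derivative `−(log p) p^{-z}`. [folklore] -/
theorem hasDerivAt_primes_cpow_neg (p : Nat.Primes) (z : ℂ) :
    HasDerivAt (fun z : ℂ ↦ ((p : ℕ) : ℂ) ^ (-z)) (-(Real.log (p : ℕ) : ℂ) * ((p : ℕ) : ℂ) ^ (-z)) z := by
  have hp0 : ((p : ℕ) : ℂ) ≠ 0 := by exact_mod_cast p.2.ne_zero
  have h := ((hasStrictDerivAt_const_cpow (x := ((p : ℕ) : ℂ)) (y := -z) (Or.inl hp0)).hasDerivAt).comp z
    (hasDerivAt_neg z)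
  refine h.congr_deriv ?_
  rw [← natCast_log]
  ring

/-- The terms of `R` are differentiable with the stated derivative (`Re z > 0`). [folklore] -/
theorem hasDerivAt_montgomeryRTerm (p : Nat.Primes) {z : ℂ} (hz : 0 < z.re) :
    HasDerivAt (montgomeryRTerm m p) (montgomeryRTermDeriv m p z) z := by
  set a : ℂ := montgomeryTwist m p with ha
  have hw : HasDerivAt (fun z : ℂ ↦ a * ((p : ℕ) : ℂ) ^ (-z))
      (a * (-(Real.log (p : ℕ) : ℂ) * ((p : ℕ) : ℂ) ^ (-z))) z :=
    (hasDerivAt_primes_cpow_neg p z).const_mul a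
  have hnorm : ‖a * ((p : ℕ) : ℂ) ^ (-z)‖ < 1 := by
    rw [ha, norm_twist_mul_cpow]
    exact Real.rpow_lt_one_of_one_lt_of_neg (by exact_mod_cast p.2.one_lt) (by linarith)
  have hslit : 1 - a * ((p : ℕ) : ℂ) ^ (-z) ∈ slitPlane := by
    refine Or.inl ?_
    rw [sub_re, one_re]
    have := (re_le_norm (a * ((p : ℕ) : ℂ) ^ (-z)))
    linarith
  have hne : 1 - a * ((p : ℕ) : ℂ) ^ (-z) ≠ 0 := slitPlane_ne_zero hslit
  have hlog := (hw.const_sub 1).clog hslit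
  have h : HasDerivAt (fun t : ℂ ↦ -log (1 - a * ((p : ℕ) : ℂ) ^ (-t)) - a * ((p : ℕ) : ℂ) ^ (-t))
      (-(-(a * (-(Real.log (p : ℕ) : ℂ) * ((p : ℕ) : ℂ) ^ (-z))) / (1 - a * ((p : ℕ) : ℂ) ^ (-z))) -
        a * (-(Real.log (p : ℕ) : ℂ) * ((p : ℕ) : ℂ) ^ (-z))) z := hlog.neg.sub hw
  have hfun : montgomeryRTerm m p =
      fun t : ℂ ↦ -log (1 - a * ((p : ℕ) : ℂ) ^ (-t)) - a * ((p : ℕ) : ℂ) ^ (-t) := rfl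
  rw [hfun]
  refine h.congr_deriv ?_
  unfold montgomeryRTermDeriv
  rw [← ha]
  field_simp
  ring

/-- Bound for the derivative of the terms of `R` on `Re z > 1`:
`‖(−log(1−w) − w)'‖ ≤ 2 (log p) p^{-2 Re z} ≤ 2 (log p) p^{-2}`. [cite: Montgomery1983, Lemma 2] -/
theorem norm_montgomeryRTermDeriv_le (p : Nat.Primes) {z : ℂ} (hz : 1 < z.re) :
    ‖montgomeryRTermDeriv m p z‖ ≤ 2 * Real.log (p : ℕ) * ((p : ℕ) : ℝ) ^ (-2 : ℝ) := by
  set w : ℂ := montgomeryTwist m p * ((p : ℕ) : ℂ) ^ (-z) with hw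
  have hwn : ‖w‖ = ((p : ℕ) : ℝ) ^ (-z.re) := norm_twist_mul_cpow m p z
  have hwh : ‖w‖ ≤ 1 / 2 := norm_twist_mul_cpow_le_half m p hz.le
  have h1w : 1 / 2 ≤ ‖1 - w‖ := by
    have := norm_sub_norm_le (1 : ℂ) w
    rw [norm_one] at this
    linarith
  have hlogp : 0 ≤ Real.log (p : ℕ) := Real.log_nonneg (by exact_mod_cast p.2.one_lt.le)
  have hp1 : (1 : ℝ) ≤ (p : ℕ) := by exact_mod_cast p.2.one_lt.le
  have hw2 : ‖w‖ ^ 2 ≤ ((p : ℕ) : ℝ) ^ (-2 : ℝ) := by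
    rw [hwn, ← Real.rpow_natCast, ← Real.rpow_mul (Nat.cast_nonneg _)]
    refine Real.rpow_le_rpow_of_exponent_le hp1 ?_
    push_cast; linarith
  show ‖(-(Real.log (p : ℕ) : ℂ) * w) * w / (1 - w)‖ ≤ _
  rw [norm_div, norm_mul, norm_mul, norm_neg, norm_real, Real.norm_of_nonneg hlogp,
    div_le_iff₀ (by linarith)]
  calc Real.log (p : ℕ) * ‖w‖ * ‖w‖ = Real.log (p : ℕ) * ‖w‖ ^ 2 := by ring
    _ ≤ Real.log (p : ℕ) * ((p : ℕ) : ℝ) ^ (-2 : ℝ) := mul_le_mul_of_nonneg_left hw2 hlogp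
    _ = 2 * Real.log (p : ℕ) * ((p : ℕ) : ℝ) ^ (-2 : ℝ) * (1 / 2) := by ring
    _ ≤ 2 * Real.log (p : ℕ) * ((p : ℕ) : ℝ) ^ (-2 : ℝ) * ‖1 - w‖ := by
        refine mul_le_mul_of_nonneg_left h1w ?_
        exact mul_nonneg (mul_nonneg (by norm_num) hlogp) (Real.rpow_nonneg (Nat.cast_nonneg _) _)

/-- `Σ_p 2 (log p) p^{-2} < ∞` (compare with `p^{-3/2}`, `log p ≤ 2√p`). [folklore] -/
theorem summable_log_mul_rpow_neg_two :
    Summable fun p : Nat.Primes ↦ 2 * Real.log (p : ℕ) * ((p : ℕ) : ℝ) ^ (-2 : ℝ) := by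
  have hs : Summable fun p : Nat.Primes ↦ 4 * ((p : ℕ) : ℝ) ^ (-(3 / 2) : ℝ) :=
    (Nat.Primes.summable_rpow.2 (by norm_num)).mul_left 4
  refine Summable.of_nonneg_of_le (fun p ↦ ?_) (fun p ↦ ?_) hs
  · exact mul_nonneg (mul_nonneg (by norm_num) (Real.log_nonneg (by exact_mod_cast p.2.one_lt.le)))
      (Real.rpow_nonneg (Nat.cast_nonneg _) _)
  · have hp0 : (0 : ℝ) ≤ (p : ℕ) := Nat.cast_nonneg _
    have hp0' : (0 : ℝ) < (p : ℕ) := by exact_mod_cast p.2.pos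
    have hlog : Real.log (p : ℕ) ≤ ((p : ℕ) : ℝ) ^ (1 / 2 : ℝ) / (1 / 2) := Real.log_le_rpow_div hp0 (by norm_num)
    calc 2 * Real.log (p : ℕ) * ((p : ℕ) : ℝ) ^ (-2 : ℝ)
        ≤ 2 * (((p : ℕ) : ℝ) ^ (1 / 2 : ℝ) / (1 / 2)) * ((p : ℕ) : ℝ) ^ (-2 : ℝ) := by
          gcongr
      _ = 4 * (((p : ℕ) : ℝ) ^ (1 / 2 : ℝ) * ((p : ℕ) : ℝ) ^ (-2 : ℝ)) := by ring
      _ = 4 * ((p : ℕ) : ℝ) ^ (-(3 / 2) : ℝ) := by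
          rw [← Real.rpow_add hp0']; norm_num

/-- The constant bounding `R'`: `C_R = Σ_p 2 (log p) p^{-2}`. [cite: Montgomery1983, Lemma 2] -/
def montgomeryCR : ℝ := ∑' p : Nat.Primes, 2 * Real.log (p : ℕ) * ((p : ℕ) : ℝ) ^ (-2 : ℝ)

/-- **`R` is holomorphic on `Re z > 1` with `R'(z) = Σ_p (term derivatives)`** (termwise
differentiation, uniformly dominated by `2 (log p) p^{-2}`). [cite: Montgomery1983, Lemma 2] -/
theorem hasDerivAt_montgomeryR {z : ℂ} (hz : 1 < z.re) :
    HasDerivAt (montgomeryR m) (∑' p : Nat.Primes, montgomeryRTermDeriv m p z) z := by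
  have hR : montgomeryR m = fun z ↦ ∑' p : Nat.Primes, montgomeryRTerm m p z := rfl
  rw [hR]
  have ht : IsOpen {z : ℂ | 1 < z.re} := isOpen_lt continuous_const continuous_re
  have ht' : IsPreconnected {z : ℂ | 1 < z.re} := (convex_halfSpace_re_gt 1).isPreconnected
  have h2 : (2 : ℂ) ∈ {z : ℂ | 1 < z.re} := by simp
  refine hasDerivAt_tsum_of_isPreconnected summable_log_mul_rpow_neg_two ht ht'
    (fun p y hy ↦ hasDerivAt_montgomeryRTerm m p (by simp at hy; linarith))
    (fun p y hy ↦ norm_montgomeryRTermDeriv_le m p hy) h2 ?_ hz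
  exact Summable.of_norm (Summable.of_nonneg_of_le (fun p ↦ norm_nonneg _)
    (fun p ↦ norm_montgomeryR_term_le m p (by norm_num))
    Literature.NumberTheory.LFunctions.summable_primes_rpow_neg_two)

/-- `‖R'(z)‖ ≤ C_R` for `Re z > 1`. [cite: Montgomery1983, Lemma 2] -/
theorem norm_tsum_montgomeryRTermDeriv_le {z : ℂ} (hz : 1 < z.re) :
    ‖∑' p : Nat.Primes, montgomeryRTermDeriv m p z‖ ≤ montgomeryCR := by
  have hs := summable_log_mul_rpow_neg_two
  refine (norm_tsum_le_tsum_norm ?_).trans (Summable.tsum_le_tsum (fun p ↦ norm_montgomeryRTermDeriv_le m p hz) ?_ hs)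
  · exact Summable.of_nonneg_of_le (fun p ↦ norm_nonneg _) (fun p ↦ norm_montgomeryRTermDeriv_le m p hz) hs
  · exact Summable.of_nonneg_of_le (fun p ↦ norm_nonneg _) (fun p ↦ norm_montgomeryRTermDeriv_le m p hz) hs

/-- `0 ≤ C_R`. [folklore] -/
theorem montgomeryCR_nonneg : 0 ≤ montgomeryCR :=
  tsum_nonneg fun p ↦ mul_nonneg (mul_nonneg (by norm_num)
    (Real.log_nonneg (by exact_mod_cast p.2.one_lt.le))) (Real.rpow_nonneg (Nat.cast_nonneg _) _)

/-! ## Weighted summability of the coefficients -/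

/-- `log(|k| + 1) ≤ 4 |k|^{1/2}` for an integer `k`. [folklore] -/
theorem log_abs_add_one_le_rpow (k : ℤ) : Real.log (|(k : ℝ)| + 1) ≤ 4 * |(k : ℝ)| ^ (1 / 2 : ℝ) := by
  rcases eq_or_ne k 0 with rfl | hk
  · simp
  have hk1 : 1 ≤ |(k : ℝ)| := by
    have : (1 : ℤ) ≤ |k| := Int.one_le_abs hk
    exact_mod_cast this
  have h1 : Real.log (|(k : ℝ)| + 1) ≤ (|(k : ℝ)| + 1) ^ (1 / 2 : ℝ) / (1 / 2) :=
    Real.log_le_rpow_div (by positivity) (by norm_num)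
  have h2 : (|(k : ℝ)| + 1) ^ (1 / 2 : ℝ) ≤ (4 * |(k : ℝ)|) ^ (1 / 2 : ℝ) :=
    Real.rpow_le_rpow (by positivity) (by linarith) (by norm_num)
  have h3 : (4 * |(k : ℝ)|) ^ (1 / 2 : ℝ) = 2 * |(k : ℝ)| ^ (1 / 2 : ℝ) := by
    rw [Real.mul_rpow (by norm_num) (abs_nonneg _)]
    congr 1
    rw [show (4 : ℝ) = 2 ^ 2 by norm_num, ← Real.rpow_natCast, ← Real.rpow_mul (by norm_num)]
    norm_num
  calc Real.log (|(k : ℝ)| + 1) ≤ (|(k : ℝ)| + 1) ^ (1 / 2 : ℝ) / (1 / 2) := h1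
    _ ≤ (2 * |(k : ℝ)| ^ (1 / 2 : ℝ)) / (1 / 2) := by rw [← h3]; gcongr
    _ = 4 * |(k : ℝ)| ^ (1 / 2 : ℝ) := by ring

/-- `log(|k| + c) ≤ 4|k|^{1/2} + log c` for `c ≥ 1`. [folklore] -/
theorem log_abs_add_le (k : ℤ) {c : ℝ} (hc : 1 ≤ c) :
    Real.log (|(k : ℝ)| + c) ≤ 4 * |(k : ℝ)| ^ (1 / 2 : ℝ) + Real.log c := by
  have h1 : |(k : ℝ)| + c ≤ (|(k : ℝ)| + 1) * c := by nlinarith [abs_nonneg (k : ℝ)]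
  calc Real.log (|(k : ℝ)| + c) ≤ Real.log ((|(k : ℝ)| + 1) * c) :=
        Real.log_le_log (by positivity) h1
    _ = Real.log (|(k : ℝ)| + 1) + Real.log c := Real.log_mul (by positivity) (by positivity)
    _ ≤ _ := by linarith [log_abs_add_one_le_rpow k]

/-- **Weighted summability**: `Σ_k |b̂(k)| log(|k| + c) < ∞` (`c ≥ 1`), from `b̂(k) ≪ (k²+1)^{-1}`.
[cite: Montgomery1983, Lemma 1 (ii)] -/
theorem summable_abs_coeff_mul_log {c : ℝ} (hc : 1 ≤ c) :
    Summable fun k : ℤ ↦ |montgomeryCoeff m k| * Real.log (|(k : ℝ)| + c) := by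
  obtain ⟨C, hC, hb⟩ := exists_abs_montgomeryCoeff_le m
  have hsq : Summable fun k : ℤ ↦ 4 * C * |(k : ℝ)| ^ (-(3 / 2) : ℝ) :=
    (Real.summable_abs_int_rpow (by norm_num)).mul_left _
  have hlogc : Summable fun k : ℤ ↦ |montgomeryCoeff m k| * Real.log c :=
    (summable_abs_montgomeryCoeff m).mul_right _
  have hmain : Summable fun k : ℤ ↦ |montgomeryCoeff m k| * (4 * |(k : ℝ)| ^ (1 / 2 : ℝ)) := by
    refine Summable.of_nonneg_of_le (fun k ↦ by positivity) (fun k ↦ ?_) hsq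
    rcases eq_or_ne k 0 with rfl | hk
    · simp
    have hk0 : 0 < |(k : ℝ)| := abs_pos.2 (by exact_mod_cast hk)
    have h1 := hb k
    calc |montgomeryCoeff m k| * (4 * |(k : ℝ)| ^ (1 / 2 : ℝ))
        ≤ C / ((k : ℝ) ^ 2 + 1) * (4 * |(k : ℝ)| ^ (1 / 2 : ℝ)) :=
          mul_le_mul_of_nonneg_right h1 (by positivity)
      _ ≤ C / |(k : ℝ)| ^ (2 : ℝ) * (4 * |(k : ℝ)| ^ (1 / 2 : ℝ)) := by
          refine mul_le_mul_of_nonneg_right ?_ (by positivity)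
          refine div_le_div_of_nonneg_left hC.le (by positivity) ?_
          rw [Real.rpow_two, sq_abs]; linarith
      _ = 4 * C * |(k : ℝ)| ^ (-(3 / 2) : ℝ) := by
          rw [Real.rpow_neg hk0.le, div_eq_mul_inv, show (3 / 2 : ℝ) = 2 - 1 / 2 by norm_num,
            Real.rpow_sub hk0]
          field_simp
  refine Summable.of_nonneg_of_le (fun k ↦ mul_nonneg (abs_nonneg _)
    (Real.log_nonneg (by linarith [abs_nonneg (k : ℝ)]))) (fun k ↦ ?_) (hmain.add hlogc)
  rw [← mul_add]
  exact mul_le_mul_of_nonneg_left (log_abs_add_le k hc) (abs_nonneg _)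

/-- `Σ_k |b̂(k)| log log(|k| + 5) < ∞`. [cite: Montgomery1983, Lemma 1 (ii)] -/
theorem summable_abs_coeff_mul_loglog :
    Summable fun k : ℤ ↦ |montgomeryCoeff m k| * Real.log (Real.log (|(k : ℝ)| + 5)) := by
  refine Summable.of_nonneg_of_le (fun k ↦ mul_nonneg (abs_nonneg _) ?_) (fun k ↦ ?_)
    (summable_abs_coeff_mul_log m (by norm_num : (1 : ℝ) ≤ 5))
  · refine Real.log_nonneg ?_
    rw [← Real.log_exp 1]
    exact Real.log_le_log (Real.exp_pos 1) (by linarith [Real.exp_one_lt_d9, abs_nonneg (k : ℝ)])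
  · refine mul_le_mul_of_nonneg_left ?_ (abs_nonneg _)
    have h5 : 1 < Real.log (|(k : ℝ)| + 5) := by
      rw [← Real.log_exp 1]
      exact Real.log_lt_log (Real.exp_pos 1) (by linarith [Real.exp_one_lt_d9, abs_nonneg (k : ℝ)])
    have := Real.log_le_sub_one_of_pos (by linarith : 0 < Real.log (|(k : ℝ)| + 5))
    linarith

/-! ## The derivative of `Φ` and `f' = Φ' f` -/

/-- **The explicit derivative** `Φ'(z) = Σ_k b̂(k) P'(z − ik) + R'(z)`. [cite: Montgomery1983, §3] -/
def montgomeryPhiDeriv (z : ℂ) : ℂ :=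
  (∑' k : ℤ, (montgomeryCoeff m k : ℂ) * deriv montgomeryP (z - k * I)) +
    ∑' p : Nat.Primes, montgomeryRTermDeriv m p z

/-- A uniform bound for `P'` on `1 + η < Re w < 2` in terms of the height: for `η > 0` there is `B`
with `‖P'(w)‖ ≤ C₁ log(|Im w| + 4) + B` (pole term `≤ 1/η` when `|Im w| ≤ 1`). [folklore] -/
theorem exists_norm_deriv_montgomeryP_le_of_eta :
    ∃ C₁ C₂ : ℝ, 0 < C₁ ∧ 0 ≤ C₂ ∧ ∀ η : ℝ, 0 < η → ∀ w : ℂ, 1 + η < w.re → w.re ≤ 2 →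
      ‖deriv montgomeryP w‖ ≤ C₁ * Real.log (|w.im| + 4) + C₂ + 1 / η := by
  obtain ⟨C₁, hC₁, h₁⟩ := exists_norm_deriv_montgomeryP_le_log
  obtain ⟨C₂, hC₂, h₂⟩ := exists_norm_deriv_montgomeryP_add_inv_le
  refine ⟨C₁, C₂, hC₁, hC₂, fun η hη w hw1 hw2 ↦ ?_⟩
  have hw1' : 1 < w.re := by linarith
  have hlog : 0 ≤ Real.log (|w.im| + 4) := Real.log_nonneg (by linarith [abs_nonneg w.im])
  by_cases him : 1 / 2 ≤ |w.im|
  · have := h₁ w hw1' hw2 him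
    have : 0 ≤ 1 / η := by positivity
    linarith
  · have him' : |w.im| ≤ 1 := by linarith [not_le.1 him]
    have h3 := h₂ w hw1' hw2 him'
    have hinv : ‖(w - 1)⁻¹‖ ≤ 1 / η := by
      rw [norm_inv, one_div]
      refine inv_anti₀ hη ?_
      calc η ≤ |(w - 1).re| := by rw [sub_re, one_re, abs_of_pos (by linarith)]; linarith
        _ ≤ ‖w - 1‖ := abs_re_le_norm _
    calc ‖deriv montgomeryP w‖ = ‖(deriv montgomeryP w + (w - 1)⁻¹) - (w - 1)⁻¹‖ := by
          rw [add_sub_cancel_right]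
      _ ≤ ‖deriv montgomeryP w + (w - 1)⁻¹‖ + ‖(w - 1)⁻¹‖ := norm_sub_le _ _
      _ ≤ C₂ + 1 / η := add_le_add h3 hinv
      _ ≤ _ := by nlinarith

/-- **The mode sum is holomorphic on `1 < Re z < 2`**, with derivative `Σ_k b̂(k) P'(z − ik)`
(termwise differentiation on a small box about the point, where all terms are dominated by the
summable `|b̂(k)|(C₁ log(|k| + c) + C₂ + 1/η)`). [cite: Montgomery1983, §3 (14) and Lemma 4] -/
theorem hasDerivAt_modeSum {z₀ : ℂ} (h1 : 1 < z₀.re) (h2 : z₀.re < 2) :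
    HasDerivAt (fun z ↦ ∑' k : ℤ, (montgomeryCoeff m k : ℂ) * montgomeryP (z - k * I))
      (∑' k : ℤ, (montgomeryCoeff m k : ℂ) * deriv montgomeryP (z₀ - k * I)) z₀ := by
  obtain ⟨C₁, C₂, hC₁, hC₂, hD⟩ := exists_norm_deriv_montgomeryP_le_of_eta
  set η : ℝ := (z₀.re - 1) / 2 with hη
  have hη0 : 0 < η := by rw [hη]; linarith
  set t : Set ℂ := {z : ℂ | 1 + η < z.re} ∩ {z : ℂ | z.re < 2} ∩
    ({z : ℂ | z₀.im - 1 < z.im} ∩ {z : ℂ | z.im < z₀.im + 1}) with ht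
  have hto : IsOpen t :=
    ((isOpen_lt continuous_const continuous_re).inter (isOpen_lt continuous_re continuous_const)).inter
      ((isOpen_lt continuous_const continuous_im).inter (isOpen_lt continuous_im continuous_const))
  have htc : IsPreconnected t :=
    (((convex_halfSpace_re_gt _).inter (convex_halfSpace_re_lt _)).inter
      ((convex_halfSpace_im_gt _).inter (convex_halfSpace_im_lt _))).isPreconnected
  have hz₀ : z₀ ∈ t := by
    simp only [ht, mem_inter_iff, mem_setOf_eq]
    refine ⟨⟨by rw [hη]; linarith, h2⟩, by constructor <;> linarith⟩
  set c : ℝ := |z₀.im| + 6 with hc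
  have hc1 : 1 ≤ c := by rw [hc]; linarith [abs_nonneg z₀.im]
  set u : ℤ → ℝ := fun k ↦ |montgomeryCoeff m k| * (C₁ * Real.log (|(k : ℝ)| + c) + (C₂ + 1 / η)) with hu
  have hA : Summable (fun k : ℤ ↦ |montgomeryCoeff m k| * (C₁ * Real.log (|(k : ℝ)| + c))) :=
    ((summable_abs_coeff_mul_log m hc1).mul_left C₁).congr fun k ↦ by ring
  have hB : Summable (fun k : ℤ ↦ |montgomeryCoeff m k| * (C₂ + 1 / η)) :=
    (summable_abs_montgomeryCoeff m).mul_right _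
  have husum : Summable u := (hA.add hB).congr fun k ↦ by simp only [hu]; ring
  refine hasDerivAt_tsum_of_isPreconnected (g := fun (k : ℤ) (z : ℂ) ↦
      (montgomeryCoeff m k : ℂ) * montgomeryP (z - k * I))
    (g' := fun (k : ℤ) (z : ℂ) ↦ (montgomeryCoeff m k : ℂ) * deriv montgomeryP (z - k * I))
    (t := t) (y₀ := z₀) (y := z₀) husum hto htc (fun k z hz ↦ ?_) (fun k z hz ↦ ?_) hz₀ ?_ hz₀
  · -- termwise derivative
    simp only [ht, mem_inter_iff, mem_setOf_eq] at hz
    have hre : 1 < (z - k * I).re := by simp; linarith [hz.1.1]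
    have h := ((differentiableAt_montgomeryP hre).hasDerivAt.comp z
      ((hasDerivAt_id z).sub_const ((k : ℂ) * I))).const_mul (montgomeryCoeff m k : ℂ)
    simpa using h
  · -- termwise bound
    simp only [ht, mem_inter_iff, mem_setOf_eq] at hz
    have hre1 : 1 + η < (z - k * I).re := by simp; linarith [hz.1.1]
    have hre2 : (z - k * I).re ≤ 2 := by simp; linarith [hz.1.2]
    have hb := hD η hη0 (z - k * I) hre1 hre2
    have him : |(z - k * I).im| + 4 ≤ |(k : ℝ)| + c := by
      have : (z - k * I).im = z.im - k := by simp
      rw [this, hc]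
      have h1 : |z.im - k| ≤ |z.im| + |(k : ℝ)| := by
        have := abs_sub (z.im) (k : ℝ); simpa using this
      have h2 : |z.im| ≤ |z₀.im| + 1 := by
        have := abs_sub_abs_le_abs_sub z.im z₀.im
        have h3 : |z.im - z₀.im| ≤ 1 := abs_le.2 ⟨by linarith [hz.2.1], by linarith [hz.2.2]⟩
        linarith
      linarith
    have hlogle : Real.log (|(z - k * I).im| + 4) ≤ Real.log (|(k : ℝ)| + c) :=
      Real.log_le_log (by linarith [abs_nonneg ((z - k * I).im)]) him
    rw [norm_mul, norm_real, Real.norm_eq_abs]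
    simp only [hu]
    refine mul_le_mul_of_nonneg_left (hb.trans ?_) (abs_nonneg _)
    nlinarith
  · -- summability at `z₀`
    have hre : ∀ k : ℤ, 1 < (z₀ - k * I).re := fun k ↦ by simpa using h1
    refine Summable.of_norm_bounded ((summable_abs_montgomeryCoeff m).mul_right
      ((montgomeryP (z₀.re : ℂ)).re)) fun k ↦ ?_
    rw [norm_mul, norm_real, Real.norm_eq_abs]
    refine mul_le_mul_of_nonneg_left ?_ (abs_nonneg _)
    have := norm_montgomeryP_le_re (hre k)
    simpa using this

/-- **`Φ` is holomorphic on `1 < Re z < 2` with derivative `Φ'`.** [cite: Montgomery1983, §3] -/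
theorem hasDerivAt_montgomeryPhi {z : ℂ} (h1 : 1 < z.re) (h2 : z.re < 2) :
    HasDerivAt (montgomeryPhi m) (montgomeryPhiDeriv m z) z :=
  (hasDerivAt_modeSum m h1 h2).add (hasDerivAt_montgomeryR m h1)

/-- **`f' = Φ' f` on `1 < Re z < 2`.** [cite: Montgomery1983, §3 (15)] -/
theorem hasDerivAt_montgomeryF {z : ℂ} (h1 : 1 < z.re) (h2 : z.re < 2) :
    HasDerivAt (montgomeryF m) (montgomeryPhiDeriv m z * montgomeryF m z) z := by
  have hexp : HasDerivAt (fun z ↦ exp (montgomeryPhi m z)) (exp (montgomeryPhi m z) * montgomeryPhiDeriv m z) z :=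
    (hasDerivAt_montgomeryPhi m h1 h2).cexp
  have hev : montgomeryF m =ᶠ[𝓝 z] fun z ↦ exp (montgomeryPhi m z) := by
    filter_upwards [(isOpen_lt continuous_const continuous_re).mem_nhds h1] with w hw
    exact montgomeryF_eq_exp_phi m hw
  rw [montgomeryF_eq_exp_phi m h1, mul_comm]
  exact hexp.congr_of_eventuallyEq hev

/-- `f'(z) = Φ'(z) f(z)` on `1 < Re z < 2`. [cite: Montgomery1983, §3 (15)] -/
theorem deriv_montgomeryF {z : ℂ} (h1 : 1 < z.re) (h2 : z.re < 2) :
    deriv (montgomeryF m) z = montgomeryPhiDeriv m z * montgomeryF m z :=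
  (hasDerivAt_montgomeryF m h1 h2).deriv

/-- `f` is differentiable at every `z` with `1 < Re z < 2`. [folklore] -/
theorem differentiableAt_montgomeryF {z : ℂ} (h1 : 1 < z.re) (h2 : z.re < 2) :
    DifferentiableAt ℂ (montgomeryF m) z :=
  (hasDerivAt_montgomeryF m h1 h2).differentiableAt

/-! ## The structure of `Φ` near the mode `k`: `Φ(z) = −b̂(k) log(z − 1 − ik) + G_k(z)` (Lemma 4) -/

/-- `log(x + y) ≤ log x + log y + log 2` for `x, y ≥ 1` (as `x + y ≤ 2xy`). [folklore] -/
theorem log_add_le_of_one_le {x y : ℝ} (hx : 1 ≤ x) (hy : 1 ≤ y) :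
    Real.log (x + y) ≤ Real.log x + Real.log y + Real.log 2 := by
  have hxy : x + y ≤ 2 * (x * y) := by nlinarith
  calc Real.log (x + y) ≤ Real.log (2 * (x * y)) := Real.log_le_log (by linarith) hxy
    _ = Real.log x + Real.log y + Real.log 2 := by
        rw [Real.log_mul (by norm_num) (by positivity), Real.log_mul (by positivity) (by positivity)]; ring

/-- `1 ≤ log(|k| + 5)`. [folklore] -/
theorem one_le_log_abs_add_five (k : ℝ) : 1 ≤ Real.log (|k| + 5) := by
  rw [← Real.log_exp 1]
  exact Real.log_le_log (Real.exp_pos 1) (by linarith [Real.exp_one_lt_d9, abs_nonneg k])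

/-- Heights near the mode `k` against another mode `j`: if `|y − k| ≤ 1/2` then
`|y − j| + 4 ≤ (|k| + 5)(|j| + 5)`. [folklore] -/
theorem abs_sub_add_four_le {y : ℝ} {k : ℤ} (h : |y - k| ≤ 1 / 2) (j : ℤ) :
    |y - j| + 4 ≤ (|(k : ℝ)| + 5) * (|(j : ℝ)| + 5) := by
  have h1 : |y - j| ≤ |(k : ℝ)| + |(j : ℝ)| + 1 / 2 := by
    calc |y - j| = |(y - k) + (k - j)| := by ring_nf
      _ ≤ |y - k| + |(k : ℝ) - j| := abs_add_le _ _
      _ ≤ 1 / 2 + (|(k : ℝ)| + |(j : ℝ)|) := add_le_add h (abs_sub _ _)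
      _ = _ := by ring
  nlinarith [abs_nonneg (k : ℝ), abs_nonneg (j : ℝ)]

/-- Hence `log(|y − j| + 4) ≤ log(|k|+5) + log(|j|+5)`. [folklore] -/
theorem log_height_le {y : ℝ} {k : ℤ} (h : |y - k| ≤ 1 / 2) (j : ℤ) :
    Real.log (|y - j| + 4) ≤ Real.log (|(k : ℝ)| + 5) + Real.log (|(j : ℝ)| + 5) := by
  rw [← Real.log_mul (by positivity) (by positivity)]
  exact Real.log_le_log (by linarith [abs_nonneg (y - j)]) (abs_sub_add_four_le h j)

/-- … and `log log(|y − j| + 4) ≤ log log(|k|+5) + log log(|j|+5) + log 2`. [folklore] -/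
theorem loglog_height_le {y : ℝ} {k : ℤ} (h : |y - k| ≤ 1 / 2) {j : ℤ} (hj : 1 / 2 ≤ |y - j|) :
    Real.log (Real.log (|y - j| + 4)) ≤
      Real.log (Real.log (|(k : ℝ)| + 5)) + Real.log (Real.log (|(j : ℝ)| + 5)) + Real.log 2 := by
  have h0 : 0 < Real.log (|y - j| + 4) := Real.log_pos (by linarith)
  calc Real.log (Real.log (|y - j| + 4))
      ≤ Real.log (Real.log (|(k : ℝ)| + 5) + Real.log (|(j : ℝ)| + 5)) :=
        Real.log_le_log h0 (log_height_le h j)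
    _ ≤ _ := log_add_le_of_one_le (one_le_log_abs_add_five _) (one_le_log_abs_add_five _)

/-- The mode sum converges absolutely at every `z` with `Re z > 1`. [folklore] -/
theorem summable_mode_terms {z : ℂ} (hz : 1 < z.re) :
    Summable fun j : ℤ ↦ (montgomeryCoeff m j : ℂ) * montgomeryP (z - j * I) := by
  have hre : ∀ j : ℤ, 1 < (z - j * I).re := fun j ↦ by simpa using hz
  refine Summable.of_norm_bounded ((summable_abs_montgomeryCoeff m).mul_right
    ((montgomeryP (z.re : ℂ)).re)) fun j ↦ ?_
  rw [norm_mul, norm_real, Real.norm_eq_abs]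
  refine mul_le_mul_of_nonneg_left ?_ (abs_nonneg _)
  have := norm_montgomeryP_le_re (hre j)
  simpa using this

/-- **Lemma 4, (18): `Φ(z) + b̂(k) log(z − 1 − ik) = G_k(z)` with `‖G_k(z)‖ ≤ A₁ + A₂ log log(|k| + 5)`**
for `1 < Re z ≤ 2`, `|Im z − k| ≤ 1/2` ("`log g_k(s) ≪_δ log log(k² + 4)`"; the implied constants depend
on `δ`). [cite: Montgomery1983, Lemma 4 (18)] -/
theorem exists_norm_phi_add_log_le :
    ∃ A₁ A₂ : ℝ, 0 ≤ A₁ ∧ 0 ≤ A₂ ∧ ∀ (k : ℤ) (z : ℂ), 1 < z.re → z.re ≤ 2 → |z.im - k| ≤ 1 / 2 →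
      ‖montgomeryPhi m z + (montgomeryCoeff m k : ℂ) * log (z - 1 - k * I)‖ ≤
        A₁ + A₂ * Real.log (Real.log (|(k : ℝ)| + 5)) := by
  obtain ⟨CE1, hCE1, hE1⟩ := exists_norm_montgomeryP_add_log_le
  obtain ⟨CE2, hCE2, hE2⟩ := exists_norm_montgomeryP_le_loglog
  set S₁ : ℝ := ∑' j : ℤ, |montgomeryCoeff m j| with hS₁
  set S₂ : ℝ := ∑' j : ℤ, |montgomeryCoeff m j| * Real.log (Real.log (|(j : ℝ)| + 5)) with hS₂
  have hS₁0 : 0 ≤ S₁ := tsum_nonneg fun j ↦ abs_nonneg _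
  have hll0 : ∀ j : ℝ, 0 ≤ Real.log (Real.log (|j| + 5)) := fun j ↦
    Real.log_nonneg (one_le_log_abs_add_five j)
  have hS₂0 : 0 ≤ S₂ := tsum_nonneg fun j ↦ mul_nonneg (abs_nonneg _) (hll0 j)
  have hP2 : 0 ≤ primeSumTwo := tsum_nonneg fun p ↦ Real.rpow_nonneg (Nat.cast_nonneg _) _
  have hl2 : 0 ≤ Real.log 2 := Real.log_nonneg one_le_two
  refine ⟨CE1 + S₁ * (Real.log 2 + CE2) + S₂ + primeSumTwo, S₁, by positivity, hS₁0,
    fun k z h1 h2 h3 ↦ ?_⟩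
  have hsum := summable_mode_terms m h1
  -- isolate the `k`-th mode
  have hsplit := hsum.tsum_eq_add_tsum_ite k
  have hre : (z - k * I).re = z.re := by simp
  have himk : (z - k * I).im = z.im - k := by simp
  have hkey : montgomeryPhi m z + (montgomeryCoeff m k : ℂ) * log (z - 1 - k * I) =
      (montgomeryCoeff m k : ℂ) * (montgomeryP (z - k * I) + log ((z - k * I) - 1)) +
      (∑' j : ℤ, if j = k then 0 else (montgomeryCoeff m j : ℂ) * montgomeryP (z - j * I)) +
      montgomeryR m z := by
    rw [montgomeryPhi, hsplit, show z - 1 - k * I = (z - k * I) - 1 by ring]; ring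
  rw [hkey]
  -- the three pieces
  have hA : ‖(montgomeryCoeff m k : ℂ) * (montgomeryP (z - k * I) + log ((z - k * I) - 1))‖ ≤ CE1 := by
    rw [norm_mul, norm_real, Real.norm_eq_abs]
    have hb : |montgomeryCoeff m k| ≤ 1 := (abs_montgomeryCoeff_lt_one m k).le
    have hE := hE1 (z - k * I) (by rw [hre]; exact h1) (by rw [hre]; exact h2) (by rw [himk]; linarith)
    calc |montgomeryCoeff m k| * ‖montgomeryP (z - k * I) + log (z - k * I - 1)‖ ≤ 1 * CE1 :=
          mul_le_mul hb hE (norm_nonneg _) zero_le_one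
      _ = CE1 := one_mul _
  have hB : ‖∑' j : ℤ, (if j = k then 0 else (montgomeryCoeff m j : ℂ) * montgomeryP (z - j * I))‖ ≤
      S₁ * (Real.log (Real.log (|(k : ℝ)| + 5)) + Real.log 2 + CE2) + S₂ := by
    set g : ℤ → ℝ := fun j ↦ |montgomeryCoeff m j| *
      (Real.log (Real.log (|(k : ℝ)| + 5)) + Real.log 2 + CE2) +
      |montgomeryCoeff m j| * Real.log (Real.log (|(j : ℝ)| + 5)) with hg
    have hgs : Summable g :=
      ((summable_abs_montgomeryCoeff m).mul_right _).add (summable_abs_coeff_mul_loglog m)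
    have hle : ∀ j : ℤ, ‖(if j = k then 0 else (montgomeryCoeff m j : ℂ) * montgomeryP (z - j * I))‖ ≤ g j := by
      intro j
      have hg0 : 0 ≤ g j := by
        simp only [hg]
        exact add_nonneg (mul_nonneg (abs_nonneg _) (by linarith [hll0 k])) (mul_nonneg (abs_nonneg _) (hll0 j))
      by_cases hjk : j = k
      · rw [if_pos hjk, norm_zero]; exact hg0
      · rw [if_neg hjk, norm_mul, norm_real, Real.norm_eq_abs]
        have hjk' : 1 / 2 ≤ |z.im - j| := by
          by_contra hcon
          push Not at hcon
          have : |(k : ℝ) - j| < 1 := by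
            calc |(k : ℝ) - j| = |(z.im - j) - (z.im - k)| := by ring_nf
              _ ≤ |z.im - j| + |z.im - k| := abs_sub _ _
              _ < 1 / 2 + 1 / 2 := add_lt_add_of_lt_of_le hcon h3
              _ = 1 := by norm_num
          have hint : |k - j| < 1 := by exact_mod_cast this
          rw [abs_lt] at hint
          exact hjk (by omega)
        have hrej : (z - j * I).re = z.re := by simp
        have himj : (z - j * I).im = z.im - j := by simp
        have hP := hE2 (z - j * I) (by rw [hrej]; exact h1) (by rw [hrej]; exact h2) (by rw [himj]; exact hjk')
        rw [himj] at hP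
        have hll := loglog_height_le h3 hjk'
        simp only [hg]
        nlinarith [abs_nonneg (montgomeryCoeff m j), norm_nonneg (montgomeryP (z - j * I)), hll0 j, hll0 k]
    refine (norm_tsum_le_tsum_norm (Summable.of_nonneg_of_le (fun j ↦ norm_nonneg _) hle hgs)).trans ?_
    refine ((Summable.of_nonneg_of_le (fun j ↦ norm_nonneg _) hle hgs).tsum_le_tsum hle hgs).trans ?_
    simp only [hg]
    rw [((summable_abs_montgomeryCoeff m).mul_right _).tsum_add (summable_abs_coeff_mul_loglog m),
      tsum_mul_right]
  have hC : ‖montgomeryR m z‖ ≤ primeSumTwo := norm_montgomeryR_le m h1.le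
  calc ‖(montgomeryCoeff m k : ℂ) * (montgomeryP (z - k * I) + log ((z - k * I) - 1)) +
        (∑' j : ℤ, if j = k then 0 else (montgomeryCoeff m j : ℂ) * montgomeryP (z - j * I)) +
        montgomeryR m z‖
      ≤ ‖(montgomeryCoeff m k : ℂ) * (montgomeryP (z - k * I) + log ((z - k * I) - 1))‖ +
        ‖∑' j : ℤ, (if j = k then 0 else (montgomeryCoeff m j : ℂ) * montgomeryP (z - j * I))‖ +
        ‖montgomeryR m z‖ := norm_add₃_le
    _ ≤ CE1 + (S₁ * (Real.log (Real.log (|(k : ℝ)| + 5)) + Real.log 2 + CE2) + S₂) + primeSumTwo :=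
        add_le_add (add_le_add hA hB) hC
    _ = _ := by ring

/-- The derivative mode sum converges absolutely for `1 < Re z ≤ 2`. [folklore] -/
theorem summable_modeDeriv_terms {z : ℂ} (h1 : 1 < z.re) (h2 : z.re ≤ 2) :
    Summable fun j : ℤ ↦ (montgomeryCoeff m j : ℂ) * deriv montgomeryP (z - j * I) := by
  obtain ⟨C₁, C₂, hC₁, hC₂, hD⟩ := exists_norm_deriv_montgomeryP_le_of_eta
  set η : ℝ := (z.re - 1) / 2 with hη
  have hη0 : 0 < η := by rw [hη]; linarith
  set c : ℝ := |z.im| + 4 with hc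
  have hc1 : 1 ≤ c := by rw [hc]; linarith [abs_nonneg z.im]
  have hA : Summable (fun j : ℤ ↦ |montgomeryCoeff m j| * (C₁ * Real.log (|(j : ℝ)| + c))) :=
    ((summable_abs_coeff_mul_log m hc1).mul_left C₁).congr fun j ↦ by ring
  have hB : Summable (fun j : ℤ ↦ |montgomeryCoeff m j| * (C₂ + 1 / η)) :=
    (summable_abs_montgomeryCoeff m).mul_right _
  refine Summable.of_norm_bounded (hA.add hB) fun j ↦ ?_
  rw [norm_mul, norm_real, Real.norm_eq_abs, ← mul_add]
  refine mul_le_mul_of_nonneg_left ?_ (abs_nonneg _)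
  have hre1 : 1 + η < (z - j * I).re := by simp; rw [hη]; linarith
  have hre2 : (z - j * I).re ≤ 2 := by simpa using h2
  refine (hD η hη0 _ hre1 hre2).trans ?_
  have him : |(z - j * I).im| + 4 ≤ |(j : ℝ)| + c := by
    have : (z - j * I).im = z.im - j := by simp
    rw [this, hc]
    have := abs_sub z.im (j : ℝ)
    linarith
  have := Real.log_le_log (by linarith [abs_nonneg ((z - j * I).im)]) him
  nlinarith

/-- **Lemma 4, (19): `Φ'(z) + b̂(k)/(z − 1 − ik) = G_k'(z)` with `‖G_k'(z)‖ ≤ A₃ + A₄ log(|k| + 5)`** for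
`1 < Re z ≤ 2`, `|Im z − k| ≤ 1/2` ("`(g_k'/g_k)(s) ≪_δ log(k² + 4)`"). [cite: Montgomery1983, Lemma 4 (19)] -/
theorem exists_norm_phiDeriv_add_inv_le :
    ∃ A₃ A₄ : ℝ, 0 ≤ A₃ ∧ 0 ≤ A₄ ∧ ∀ (k : ℤ) (z : ℂ), 1 < z.re → z.re ≤ 2 → |z.im - k| ≤ 1 / 2 →
      ‖montgomeryPhiDeriv m z + (montgomeryCoeff m k : ℂ) / (z - 1 - k * I)‖ ≤
        A₃ + A₄ * Real.log (|(k : ℝ)| + 5) := by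
  obtain ⟨CD1, hCD1, hD1⟩ := exists_norm_deriv_montgomeryP_le_log
  obtain ⟨CD2, hCD2, hD2⟩ := exists_norm_deriv_montgomeryP_add_inv_le
  set S₁ : ℝ := ∑' j : ℤ, |montgomeryCoeff m j| with hS₁
  set S₃ : ℝ := ∑' j : ℤ, |montgomeryCoeff m j| * Real.log (|(j : ℝ)| + 5) with hS₃
  have hS₁0 : 0 ≤ S₁ := tsum_nonneg fun j ↦ abs_nonneg _
  have hl0 : ∀ j : ℝ, 0 ≤ Real.log (|j| + 5) := fun j ↦ (one_le_log_abs_add_five j).trans' zero_le_one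
  have hS₃0 : 0 ≤ S₃ := tsum_nonneg fun j ↦ mul_nonneg (abs_nonneg _) (hl0 j)
  refine ⟨CD2 + CD1 * S₃ + montgomeryCR, CD1 * S₁, by positivity [montgomeryCR_nonneg], by positivity,
    fun k z h1 h2 h3 ↦ ?_⟩
  have hsum := summable_modeDeriv_terms m h1 h2
  have hsplit := hsum.tsum_eq_add_tsum_ite k
  have hre : (z - k * I).re = z.re := by simp
  have himk : (z - k * I).im = z.im - k := by simp
  have hkey : montgomeryPhiDeriv m z + (montgomeryCoeff m k : ℂ) / (z - 1 - k * I) =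
      (montgomeryCoeff m k : ℂ) * (deriv montgomeryP (z - k * I) + ((z - k * I) - 1)⁻¹) +
      (∑' j : ℤ, if j = k then 0 else (montgomeryCoeff m j : ℂ) * deriv montgomeryP (z - j * I)) +
      ∑' p : Nat.Primes, montgomeryRTermDeriv m p z := by
    rw [montgomeryPhiDeriv, hsplit, show z - 1 - k * I = (z - k * I) - 1 by ring, div_eq_mul_inv]; ring
  rw [hkey]
  have hA : ‖(montgomeryCoeff m k : ℂ) * (deriv montgomeryP (z - k * I) + ((z - k * I) - 1)⁻¹)‖ ≤ CD2 := by
    rw [norm_mul, norm_real, Real.norm_eq_abs]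
    have hb : |montgomeryCoeff m k| ≤ 1 := (abs_montgomeryCoeff_lt_one m k).le
    have hE := hD2 (z - k * I) (by rw [hre]; exact h1) (by rw [hre]; exact h2) (by rw [himk]; linarith)
    calc |montgomeryCoeff m k| * ‖deriv montgomeryP (z - k * I) + (z - k * I - 1)⁻¹‖ ≤ 1 * CD2 :=
          mul_le_mul hb hE (norm_nonneg _) zero_le_one
      _ = CD2 := one_mul _
  have hB : ‖∑' j : ℤ, (if j = k then 0 else (montgomeryCoeff m j : ℂ) * deriv montgomeryP (z - j * I))‖ ≤
      CD1 * S₁ * Real.log (|(k : ℝ)| + 5) + CD1 * S₃ := by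
    set g : ℤ → ℝ := fun j ↦ |montgomeryCoeff m j| * (CD1 * Real.log (|(k : ℝ)| + 5)) +
      |montgomeryCoeff m j| * Real.log (|(j : ℝ)| + 5) * CD1 with hg
    have hgs : Summable g :=
      ((summable_abs_montgomeryCoeff m).mul_right _).add
        ((summable_abs_coeff_mul_log m (by norm_num : (1 : ℝ) ≤ 5)).mul_right CD1)
    have hle : ∀ j : ℤ, ‖(if j = k then 0 else (montgomeryCoeff m j : ℂ) * deriv montgomeryP (z - j * I))‖ ≤ g j := by
      intro j
      have hg0 : 0 ≤ g j := by
        simp only [hg]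
        exact add_nonneg (mul_nonneg (abs_nonneg _) (mul_nonneg hCD1.le (hl0 k)))
          (mul_nonneg (mul_nonneg (abs_nonneg _) (hl0 j)) hCD1.le)
      by_cases hjk : j = k
      · rw [if_pos hjk, norm_zero]; exact hg0
      · rw [if_neg hjk, norm_mul, norm_real, Real.norm_eq_abs]
        have hjk' : 1 / 2 ≤ |z.im - j| := by
          by_contra hcon
          push Not at hcon
          have : |(k : ℝ) - j| < 1 := by
            calc |(k : ℝ) - j| = |(z.im - j) - (z.im - k)| := by ring_nf
              _ ≤ |z.im - j| + |z.im - k| := abs_sub _ _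
              _ < 1 / 2 + 1 / 2 := add_lt_add_of_lt_of_le hcon h3
              _ = 1 := by norm_num
          have hint : |k - j| < 1 := by exact_mod_cast this
          rw [abs_lt] at hint
          exact hjk (by omega)
        have hrej : (z - j * I).re = z.re := by simp
        have himj : (z - j * I).im = z.im - j := by simp
        have hP := hD1 (z - j * I) (by rw [hrej]; exact h1) (by rw [hrej]; exact h2) (by rw [himj]; exact hjk')
        rw [himj] at hP
        have hll := log_height_le h3 j
        have h1' : |montgomeryCoeff m j| * ‖deriv montgomeryP (z - j * I)‖ ≤
            |montgomeryCoeff m j| * (CD1 * Real.log (|z.im - j| + 4)) :=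
          mul_le_mul_of_nonneg_left hP (abs_nonneg _)
        have h2' : |montgomeryCoeff m j| * (CD1 * Real.log (|z.im - j| + 4)) ≤
            |montgomeryCoeff m j| * (CD1 * (Real.log (|(k : ℝ)| + 5) + Real.log (|(j : ℝ)| + 5))) :=
          mul_le_mul_of_nonneg_left (mul_le_mul_of_nonneg_left hll hCD1.le) (abs_nonneg _)
        simp only [hg]
        linarith
    refine (norm_tsum_le_tsum_norm (Summable.of_nonneg_of_le (fun j ↦ norm_nonneg _) hle hgs)).trans ?_
    refine ((Summable.of_nonneg_of_le (fun j ↦ norm_nonneg _) hle hgs).tsum_le_tsum hle hgs).trans ?_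
    simp only [hg]
    rw [((summable_abs_montgomeryCoeff m).mul_right _).tsum_add
        ((summable_abs_coeff_mul_log m (by norm_num : (1 : ℝ) ≤ 5)).mul_right CD1),
      tsum_mul_right, tsum_mul_right]
    nlinarith
  have hC : ‖∑' p : Nat.Primes, montgomeryRTermDeriv m p z‖ ≤ montgomeryCR :=
    norm_tsum_montgomeryRTermDeriv_le m h1
  calc ‖(montgomeryCoeff m k : ℂ) * (deriv montgomeryP (z - k * I) + ((z - k * I) - 1)⁻¹) +
        (∑' j : ℤ, if j = k then 0 else (montgomeryCoeff m j : ℂ) * deriv montgomeryP (z - j * I)) +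
        ∑' p : Nat.Primes, montgomeryRTermDeriv m p z‖
      ≤ ‖(montgomeryCoeff m k : ℂ) * (deriv montgomeryP (z - k * I) + ((z - k * I) - 1)⁻¹)‖ +
        ‖∑' j : ℤ, (if j = k then 0 else (montgomeryCoeff m j : ℂ) * deriv montgomeryP (z - j * I))‖ +
        ‖∑' p : Nat.Primes, montgomeryRTermDeriv m p z‖ := norm_add₃_le
    _ ≤ CD2 + (CD1 * S₁ * Real.log (|(k : ℝ)| + 5) + CD1 * S₃) + montgomeryCR :=
        add_le_add (add_le_add hA hB) hC
    _ = _ := by ring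

end Euler

end Literature.Barriers.RiemannHypothesis

end
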